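import Mathlib.RingTheory.AlgebraicIndependent.TranscendenceBasis
import Literature.AnabelianGeometry.AbsoluteAnabelian.AbsTopIII.PadicEmbeddingRigidity
import Literature.AnabelianGeometry.AbsoluteAnabelian.AbsTopIII.KummerFaithful
import Literature.FieldTheory.Regular.FiniteAlgebraicClosureAnyChar
import Literature.NumberTheory.DiophantineGeometry.FunctionFieldPointCountRationalProofs
import Literature.NumberTheory.DiophantineGeometry.FunctionFieldSchmidtDegreeOneExtensionProofs
import Literature.NumberTheory.DiophantineGeometry.FunctionFieldGenusRiemannRochProofs
import Literature.NumberTheory.DiophantineGeometry.FunctionFieldGenusApproximationProofs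
import HarnessLib

/-!
# [AbsTopIII] Remark 1.5.4 (iii), second half: `ℚ_p(x_i)_{i ∈ I}` (`I` infinite) is NOT
# sub-`p`-adic

Proof-only companion (no new definitions) to `AbsTopIII/KummerFaithful.lean` (abc-iut-L4-t1,
p404026).  S. Mochizuki, *Topics in Absolute Anabelian Geometry III*, §1, Rmk. 1.5.4 (iii),
manuscript p. 34 (lit key `paper:url-5493eb38cbb7`): "if [...] `I` is an infinite set, then the
field `k := ℚ_p(x_i)_{i ∈ I}` [...] constitutes an example of a Kummer-faithful field which is not
sub-`p`-adic."  The named fact `Rmk_1_5_4_iii` is the conjunction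
`IsKummerFaithful k ∧ ¬ IsSubpadic k` for `k = FractionRing (MvPolynomial I ℚ_[p])`; this file
kernel-proves the SECOND conjunct (`not_isSubpadic_fractionRing_mvPolynomial`) and records the
named fact modulo the first (`Rmk_1_5_4_iii_of_kummerFaithful_clause`; the Kummer-faithfulness of
`k` — abelian-variety clause included — is NOT asserted here).

Since "sub-`p`-adic" ([Mzk5] Def. 15.4 (i); the cell's `IsSubpadic`) allows an ABSTRACT embedding
of `k` into a finitely generated extension `L` of SOME `ℚ_q`, the proof controls abstract ring
homomorphisms `ψ : ℚ_p → L`: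
* `isAlgebraic_of_forall_exists_pow_prime_pow` : in a finitely generated extension `L/K`, a
  nonzero element with `ℓ^n`-th roots for all `n` is algebraic over `K` (pole argument in a
  function field of one variable, as in `KummerFaithfulFGExtensionProofs`, `ℓ`-power version);
* `padicRingHom_mem_algebraicClosure` : hence `ψ(ℚ_p)` lies in the relative algebraic closure
  `L₀` of `ℚ_q` in `L` (images of principal units `1 + p x` are `ℓ^∞`-divisible), which is a FINITE
  extension of `ℚ_q` (tree `Literature.FieldTheory.Regular.finiteDimensional_algebraicClosure`);
* `IsSubpadicFor.prime_eq_of_padicRingHom`, `isSubpadicFor_padic_iff` : a field containing `ℚ_p`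
  is sub-`q`-adic only for `q = p` (sanity of the cell's abstract `IsSubpadicFor`);
* by `eq_of_padicRingHom` / `padicRingHom_eq_algebraMap` (`PadicEmbeddingRigidity.lean`),
  `q = p` and `ψ` is the structure map; so the embedding `k → L` is a `ℚ_p`-algebra map and carries
  the algebraically independent family `(x_i)_{i ∈ I}` to one in `L`, whose transcendence degree
  over `ℚ_p` is finite (Mathlib `Algebra.IsAlgebraic.trdeg_le_cardinalMk`) — contradiction.

HONEST FRAMING: classical; nothing here bears on [IUTchIII] Cor. 3.12; typed ≠ discharged for
the first conjunct. [cite: MochizukiAbsTopIII2015, Rmk 1.5.4 (iii) p.34]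
-/

noncomputable section

open scoped Classical IntermediateField

namespace Literature.AnabelianGeometry.AbsoluteAnabelian.AbsTopIII

open Literature.NumberTheory.DiophantineGeometry
open Literature.NumberTheory.DiophantineGeometry.AlgFunctionField

universe u v w

/-! ## `ℓ^∞`-divisible elements of finitely generated extensions are algebraic -/

/-- In an algebraic function field of one variable `F/K`, a nonzero element admitting an
`ℓ^n`-th root for every `n` (`ℓ` prime) is algebraic over `K`: a transcendental element has a pole
`v`, and `ord_v x = ℓ^n · ord_v y_n` would make `ord_v x` divisible by every power of `ℓ`.
[cite: MochizukiAbsTopIII2015, Rmk 1.5.4 (ii) p.34] -/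
private theorem isAlgebraic_of_forall_exists_pow_prime_pow_of_isAlgFunctionField {K : Type v}
    {F : Type w} [Field K] [Field F] [Algebra K F] [IsAlgFunctionField K F] {ℓ : ℕ} (hℓ : ℓ.Prime)
    {x : F} (hx0 : x ≠ 0) (hdiv : ∀ n : ℕ, ∃ y : F, y ^ (ℓ ^ n) = x) : IsAlgebraic K x := by
  by_contra htr
  obtain ⟨v, hv⟩ := exists_placeOver_not_mem (K := K) (F := F) (show Transcendental K x from htr)
  have hneg : ¬ 0 ≤ v.ord x := fun h ↦ hv ((v.mem_toValuationSubring_iff_ord_nonneg hx0).2 h)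
  obtain ⟨y, hy⟩ := hdiv (v.ord x).natAbs
  have hN : ℓ ^ (v.ord x).natAbs ≠ 0 := pow_ne_zero _ hℓ.ne_zero
  have hy0 : y ≠ 0 := by
    rintro rfl
    exact hx0 (by rw [← hy, zero_pow hN])
  have hdvd : ((ℓ ^ (v.ord x).natAbs : ℕ) : ℤ) ∣ v.ord x :=
    ⟨v.ord y, by rw [← v.ord_pow hy0, hy]⟩
  have h0 : v.ord x = 0 :=
    Int.eq_zero_of_dvd_of_natAbs_lt_natAbs hdvd
      (by rw [Int.natAbs_natCast]; exact Nat.lt_pow_self hℓ.one_lt)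
  exact hneg h0.ge

/-- **`ℓ^∞`-divisible elements of a finitely generated field extension are algebraic over the
base**: if `E/k` is finitely generated, `ℓ` is a prime, and `0 ≠ x ∈ E` has an `ℓ^n`-th root in
`E` for every `n`, then `x` is algebraic over `k` (the relative algebraic closure `M` of `k(x)` in
`E` is a function field of one variable over `k` containing all the roots).
[cite: MochizukiAbsTopIII2015, Rmk 1.5.4 (ii) p.34] -/
theorem isAlgebraic_of_forall_exists_pow_prime_pow {k : Type u} {E : Type v} [Field k] [Field E]
    [Algebra k E] [Algebra.EssFiniteType k E] {ℓ : ℕ} (hℓ : ℓ.Prime) {x : E} (hx0 : x ≠ 0)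
    (hdiv : ∀ n : ℕ, ∃ y : E, y ^ (ℓ ^ n) = x) : IsAlgebraic k x := by
  by_contra htr
  have htr' : Transcendental k x := htr
  set K₀ : IntermediateField k E := k⟮x⟯ with hK₀
  haveI : IsAlgFunctionField k K₀ := isAlgFunctionField_adjoin_simple htr'
  haveI : Algebra.EssFiniteType K₀ E := Algebra.EssFiniteType.of_comp k K₀ E
  set M : IntermediateField K₀ E := algebraicClosure K₀ E with hM
  haveI : FiniteDimensional K₀ M :=
    Literature.FieldTheory.Regular.finiteDimensional_algebraicClosure
  haveI : IsAlgFunctionField k M :=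
    isAlgFunctionField_of_finiteDimensional (K := k) (F := K₀) (F' := M)
  have hxK₀ : x ∈ K₀ := IntermediateField.mem_adjoin_simple_self k x
  have hxalgK₀ : IsAlgebraic K₀ x := isAlgebraic_algebraMap (R := K₀) (A := E) (⟨x, hxK₀⟩ : K₀)
  have hxM : x ∈ M := by
    rw [hM, mem_algebraicClosure_iff]
    exact hxalgK₀
  set xM : M := ⟨x, hxM⟩ with hxMdef
  have hxM0 : xM ≠ 0 := fun h ↦ hx0 (congrArg Subtype.val h)
  have hdivM : ∀ n : ℕ, ∃ y : M, y ^ (ℓ ^ n) = xM := by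
    intro n
    obtain ⟨y, hy⟩ := hdiv n
    have hyM : y ∈ M := by
      rw [hM, mem_algebraicClosure_iff]
      refine IsAlgebraic.of_pow (pow_pos hℓ.pos n) ?_
      rw [hy]
      exact hxalgK₀
    exact ⟨⟨y, hyM⟩, Subtype.ext hy⟩
  have halg : IsAlgebraic k xM :=
    isAlgebraic_of_forall_exists_pow_prime_pow_of_isAlgFunctionField (K := k) hℓ hxM0 hdivM
  haveI : IsScalarTower k M E := IsScalarTower.of_algebraMap_eq fun _ ↦ rfl
  exact htr (halg.algebraMap (A := E))

/-! ## Ring homomorphisms `ℚ_p → L`, `L` finitely generated over `ℚ_q` -/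

section PadicHom

variable {p q : ℕ} [Fact p.Prime] [Fact q.Prime] {L : Type v} [Field L] [Algebra ℚ_[q] L]
  [Algebra.EssFiniteType ℚ_[q] L]

variable (q) in
/-- The image of any ring homomorphism `ψ : ℚ_p → L` into a finitely generated extension `L` of
`ℚ_q` consists of elements ALGEBRAIC over `ℚ_q`: for `‖x‖_p ≤ 1` the principal unit `1 + p x` is
`ℓ^∞`-divisible (`ℓ ≠ p`), so `ψ(1 + p x)` is algebraic, hence so is `ψ x`; in general
`x = p^{-n} x'` with `‖x'‖_p ≤ 1`. [cite: MochizukiAbsTopIII2015, Rmk 1.5.4 (iii) p.34] -/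
theorem padicRingHom_mem_algebraicClosure (ψ : ℚ_[p] →+* L) (x : ℚ_[p]) :
    ψ x ∈ algebraicClosure ℚ_[q] L := by
  have hp : p.Prime := Fact.out
  have hp1 : (1 : ℝ) < p := by exact_mod_cast hp.one_lt
  set L₀ : IntermediateField ℚ_[q] L := algebraicClosure ℚ_[q] L
  obtain ⟨ℓ, hℓ, hℓp⟩ := exists_prime_ne p
  -- integral elements first
  have hint : ∀ x' : ℚ_[p], ‖x'‖ ≤ 1 → ψ x' ∈ L₀ := by
    intro x' hx'
    set u : ℚ_[p] := 1 + p * x' with hu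
    have hu1 : ‖u - 1‖ < 1 := by
      rw [hu, add_sub_cancel_left, norm_mul, Padic.norm_p]
      calc (p : ℝ)⁻¹ * ‖x'‖ ≤ (p : ℝ)⁻¹ * 1 := by gcongr
        _ < 1 := by rw [mul_one]; exact inv_lt_one_of_one_lt₀ hp1
    have hu0 : u ≠ 0 := by
      intro h
      rw [h, zero_sub, norm_neg, norm_one] at hu1
      exact lt_irrefl _ hu1
    have hψu : ψ u ∈ L₀ := by
      rw [mem_algebraicClosure_iff]
      refine isAlgebraic_of_forall_exists_pow_prime_pow hℓ ((map_ne_zero ψ).mpr hu0) fun n => ?_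
      obtain ⟨y, hy⟩ := Padic.exists_pow_prime_pow_eq_of_norm_sub_one_lt hu1 hℓ hℓp n
      exact ⟨ψ y, by rw [← map_pow, hy]⟩
    have hp0 : (p : L) ≠ 0 := by
      haveI : CharZero L := charZero_of_injective_algebraMap (algebraMap ℚ_[q] L).injective
      exact_mod_cast hp.ne_zero
    have hx'eq : ψ x' = (ψ u - 1) / (p : L) := by
      rw [hu, map_add, map_one, map_mul, map_natCast, add_sub_cancel_left, mul_div_cancel_left₀ _ hp0]
    rw [hx'eq]
    refine div_mem (sub_mem hψu (one_mem _)) ?_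
    exact_mod_cast (natCast_mem L₀ p)
  -- general `x = x' / p^n`
  obtain ⟨n, hn⟩ := pow_unbounded_of_one_lt ‖x‖ hp1
  have hpn : ((p : ℚ_[p]) ^ n) ≠ 0 := pow_ne_zero _ (by exact_mod_cast hp.ne_zero)
  set x' : ℚ_[p] := (p : ℚ_[p]) ^ n * x with hx'
  have hx'1 : ‖x'‖ ≤ 1 := by
    rw [hx', norm_mul, norm_pow, Padic.norm_p, inv_pow]
    rw [inv_mul_le_iff₀ (by positivity), mul_one]
    exact hn.le
  have hxeq : x = x' / (p : ℚ_[p]) ^ n := by rw [hx', mul_div_cancel_left₀ _ hpn]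
  have hpL : ((p : L) ^ n) ∈ L₀ := pow_mem (by exact_mod_cast (natCast_mem L₀ p)) n
  rw [hxeq, map_div₀, map_pow, map_natCast]
  exact div_mem (hint x' hx'1) hpL

/-- A ring homomorphism `ψ : ℚ_p → L` into a finitely generated extension `L` of `ℚ_q` forces
`q = p` (via `eq_of_padicRingHom` applied to `ψ` co-restricted to `L₀`, which is finite over `ℚ_q`).
[cite: MochizukiAbsTopIII2015, Rmk 1.5.4 (iii) p.34] -/
theorem eq_of_padicRingHom_fg (ψ : ℚ_[p] →+* L) : q = p := by
  haveI : FiniteDimensional ℚ_[q] (algebraicClosure ℚ_[q] L) :=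
    Literature.FieldTheory.Regular.finiteDimensional_algebraicClosure
  exact eq_of_padicRingHom
    (ψ.codRestrict (algebraicClosure ℚ_[q] L) (padicRingHom_mem_algebraicClosure q ψ))

/-- A ring homomorphism `ψ : ℚ_p → L` into a finitely generated extension `L` of `ℚ_p` is the
structure map (rigidity `padicRingHom_eq_algebraMap` applied to the finite extension `L₀`).
[cite: MochizukiAbsTopIII2015, Rmk 1.5.4 (iii) p.34] -/
theorem padicRingHom_eq_algebraMap_fg [Algebra ℚ_[p] L] [Algebra.EssFiniteType ℚ_[p] L]
    (ψ : ℚ_[p] →+* L) : ψ = algebraMap ℚ_[p] L := by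
  haveI : FiniteDimensional ℚ_[p] (algebraicClosure ℚ_[p] L) :=
    Literature.FieldTheory.Regular.finiteDimensional_algebraicClosure
  have h := padicRingHom_eq_algebraMap
    (ψ.codRestrict (algebraicClosure ℚ_[p] L) (padicRingHom_mem_algebraicClosure p ψ))
  refine RingHom.ext fun x => ?_
  have hx := congrArg (fun f : ℚ_[p] →+* algebraicClosure ℚ_[p] L => ((f x : _) : L)) h
  simpa [RingHom.codRestrict_apply] using hx

end PadicHom

/-! ## The prime of a sub-`p`-adic field containing `ℚ_p` is `p` -/

/-- A field receiving a ring homomorphism from `ℚ_p` (e.g. any field containing `ℚ_p`, any MLF of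
residue characteristic `p`) is sub-`q`-adic ([Mzk5] Def. 15.4 (i), the cell's `IsSubpadicFor`)
only for `q = p` — rigidity of `ℚ_p` under abstract embeddings.
[cite: MochizukiAbsTopIII2015, Rmk 1.5.4 (iii) p.34] -/
theorem IsSubpadicFor.prime_eq_of_padicRingHom {p q : ℕ} [Fact p.Prime] [Fact q.Prime]
    {k : Type u} [Field k] (f : ℚ_[p] →+* k) (h : IsSubpadicFor k q) : q = p := by
  obtain ⟨L, _, _, hfg, ⟨ι⟩⟩ := h.exists_embedding
  haveI : Algebra.EssFiniteType ℚ_[q] L := IntermediateField.fg_top_iff.mp hfg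
  exact eq_of_padicRingHom_fg (ι.comp f)

/-- In particular `ℚ_p` itself is sub-`q`-adic iff `q = p`.
[cite: MochizukiAbsTopIII2015, Rmk 1.5.4 (iii) p.34] -/
theorem isSubpadicFor_padic_iff {p q : ℕ} [Fact p.Prime] [Fact q.Prime] :
    IsSubpadicFor ℚ_[p] q ↔ q = p := by
  refine ⟨fun h => h.prime_eq_of_padicRingHom (RingHom.id _), ?_⟩
  rintro rfl
  exact ⟨⟨_, inferInstance, inferInstance, IntermediateField.fg_top_iff.mpr inferInstance,
    ⟨RingHom.id _⟩⟩⟩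

/-! ## `ℚ_p(x_i)_{i ∈ I}` is not sub-`p`-adic for `I` infinite -/

/-- [AbsTopIII] Rmk. 1.5.4 (iii), second half: for `I` infinite, the rational function field
`ℚ_p(x_i)_{i ∈ I} = Frac ℚ_p[x_i]_{i ∈ I}` is NOT sub-`p`-adic (for ANY prime `q` and ANY
abstract embedding into a finitely generated extension `L` of `ℚ_q`: such an embedding restricts on
`ℚ_p` to the structure map with `q = p`, so the `x_i` stay algebraically independent over `ℚ_p`
in `L`, whose transcendence degree is finite). [cite: MochizukiAbsTopIII2015, Rmk 1.5.4 (iii) p.34] -/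
theorem not_isSubpadic_fractionRing_mvPolynomial (p : ℕ) [Fact p.Prime] (I : Type) [Infinite I] :
    ¬ IsSubpadic (FractionRing (MvPolynomial I ℚ_[p])) := by
  rintro ⟨q, hq, ⟨L, _, _, hfg, ⟨φ⟩⟩⟩
  haveI : Algebra.EssFiniteType ℚ_[q] L := IntermediateField.fg_top_iff.mp hfg
  set K := FractionRing (MvPolynomial I ℚ_[p])
  -- the restriction of `φ` to `ℚ_p` forces `q = p` and is the structure map
  set ψ : ℚ_[p] →+* L := φ.comp (algebraMap ℚ_[p] K) with hψ
  have hpq : p = q := (eq_of_padicRingHom_fg ψ).symm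
  subst hpq
  have hψeq : ψ = algebraMap ℚ_[p] L := padicRingHom_eq_algebraMap_fg ψ
  -- `φ` is a `ℚ_p`-algebra homomorphism
  let φₐ : K →ₐ[ℚ_[p]] L :=
    { φ with
      commutes' := fun c => by
        have := congrArg (fun f : ℚ_[p] →+* L => f c) hψeq
        simpa [hψ] using this }
  have hφinj : Function.Injective (φₐ : K → L) := fun a b h => φ.injective h
  -- the `x_i` are algebraically independent over `ℚ_p` in `K`, hence in `L`
  have hX : AlgebraicIndependent ℚ_[p]
      (fun i => algebraMap (MvPolynomial I ℚ_[p]) K (MvPolynomial.X i)) :=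
    (MvPolynomial.algebraicIndependent_X I ℚ_[p]).map'
      (f := IsScalarTower.toAlgHom ℚ_[p] (MvPolynomial I ℚ_[p]) K)
      (IsFractionRing.injective (MvPolynomial I ℚ_[p]) K)
  have hXL : AlgebraicIndependent ℚ_[p]
      (φₐ ∘ fun i => algebraMap (MvPolynomial I ℚ_[p]) K (MvPolynomial.X i)) :=
    hX.map' hφinj
  -- but `L` has finite transcendence degree over `ℚ_p`
  obtain ⟨s, hs⟩ := IntermediateField.fg_top ℚ_[p] L
  have halg : Algebra.IsAlgebraic (Algebra.adjoin ℚ_[p] (s : Set L)) L := by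
    rw [← IntermediateField.isAlgebraic_adjoin_iff_top, hs, Algebra.isAlgebraic_iff_isIntegral]
    exact Algebra.isIntegral_of_surjective IntermediateField.topEquiv.surjective
  have htr : Algebra.trdeg ℚ_[p] L ≤ Cardinal.mk (s : Set L) :=
    Algebra.IsAlgebraic.trdeg_le_cardinalMk ℚ_[p] (s : Set L)
  have hfin : Cardinal.mk (s : Set L) < Cardinal.aleph0 := Cardinal.lt_aleph0_of_finite _
  have hI : Cardinal.mk I ≤ Algebra.trdeg ℚ_[p] L := hXL.cardinalMk_le_trdeg
  exact absurd (hI.trans_lt (htr.trans_lt hfin)) (not_lt.mpr (Cardinal.aleph0_le_mk I))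

/-- The named fact `Rmk_1_5_4_iii` ([AbsTopIII] Rmk. 1.5.4 (iii) p. 34) CONDITIONALLY on its first
conjunct: the second conjunct ("not sub-`p`-adic") is `not_isSubpadic_fractionRing_mvPolynomial`
(proved); the hypothesis `hKF` is the Kummer-faithfulness of `ℚ_p(x_i)_{i ∈ I}` (with the tree's
`IsKummerFaithful`, abelian-variety clause included) — NOT proved here.
[cite: MochizukiAbsTopIII2015, Rmk 1.5.4 (iii) p.34] -/
theorem Rmk_1_5_4_iii_of_kummerFaithful_clause
    (hKF : ∀ (p : ℕ) [Fact p.Prime] (I : Type) [Infinite I],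
      IsKummerFaithful (FractionRing (MvPolynomial I ℚ_[p]))) :
    Rmk_1_5_4_iii :=
  fun p _ I _ => ⟨hKF p I, not_isSubpadic_fractionRing_mvPolynomial p I⟩

end Literature.AnabelianGeometry.AbsoluteAnabelian.AbsTopIII
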